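import Summits.AtomisticToContinuum.HydrodynamicLimit.Theorems.ImplosionDichotomyHydroLimitProfilewiseBandGuardedInputsDefs
import Summits.AtomisticToContinuum.HydrodynamicLimit.Theorems.ImplosionDichotomyHydroLimitInBandWindowContinuityEstimate
import Literature.MathematicalPhysics.KineticTheory.HardSphereEulerProofs
import HarnessLib

/-!
# Window continuity of the relative-entropy ledger, in band, from the GUARDED tails (stub `stub_windowContinuityInBandG`
# of line `IdeatorOneSketch` v19, crux `HydroLimitProfilewiseBand`, stmt-AtomisticToContinuum-17372)

Support file (`--supports stmt-AtomisticToContinuum-17372`).  Registered stub of skeleton v19: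
`stub_windowContinuityInBandG : CollisionActivityTailsGuarded → EnergyActivityTailsGuarded → EnergyCurrentTailsGuarded →
WindowContinuityInBandGuarded` (statements: `Theorems/ImplosionDichotomyHydroLimitProfilewiseBandGuardedInputsDefs.lean`).
It is the landed 9133 stub `HydroLimitInBandContinuity.stub_windowContinuityInBand` (CAT → CEAT → ECT → WindowContinuityInBand)
re-run with the three true-law inputs GUARD-RELATIVISED: the conclusion acquires the packing threshold `ηW := min η₁ (min η₂ η₃)`
(`∃ ηW` outermost, guard `ρ_{t′} σ³ < ηW` on `[0,T)` inserted after the solution), which is handed to the three inputs at the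
solution in scope; every other line — the three inputs at ONE fixed level each, the slab constants, the one-window estimate
`abs_klDiv_window_sub_le` (landed, reused by name) and the `(N+1) ν_N · const` bookkeeping — is the template verbatim.
QUANTIFIER PLUMBING ONLY.  prover-line-stmt-AtomisticToContinuum-17372-c13-0 (lead, line cycle 14).
-/

noncomputable section

open MeasureTheory Filter Set Topology InformationTheory
open scoped ENNReal

namespace Summit.AtomisticToContinuum.HydrodynamicLimit.Theorems.HydroLimitGuardedWindowContinuity

open Literature.MathematicalPhysics.KineticTheory Literature.Analysis.FluidPDE
open Literature.Analysis.FunctionSpaces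
open Summit.AtomisticToContinuum.HydrodynamicLimit.Theses
open Summit.AtomisticToContinuum.HydrodynamicLimit.Theorems
  (lintegral_meanVelObs_localGibbsMeasure_le lintegral_norm_sq_gaussMeasure)
open Summit.AtomisticToContinuum.HydrodynamicLimit.Theorems.HydroLimitInBandContinuity
open Summit.AtomisticToContinuum.HydrodynamicLimit.Theorems.HydroLimitGuardedInputs

/-- **STUB `stub_windowContinuityInBandG` of line `IdeatorOneSketch` v19 (crux stmt-17372).** CAT_η (momentum activity), EAT_η
(energy activity) and ECT_η (cubic tails), each at ONE fixed level and each asked only along the guarded solution in scope, give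
the crude short-time continuity of `H_N` along the explicit reference family, in band, below the packing threshold
`ηW := min η₁ (min η₂ η₃)`. [cite: Yau1991, §2] -/
theorem stub_windowContinuityInBandG :
    CollisionActivityTailsGuarded → EnergyActivityTailsGuarded → EnergyCurrentTailsGuarded →
      WindowContinuityInBandGuarded := by
  -- adapted from Theorems/ImplosionDichotomyHydroLimitInBandWindowContinuity.lean (`stub_windowContinuityInBand`, 9133 v8):
  -- the three packing guards are collected into `ηW := min η₁ (min η₂ η₃)` and handed to the inputs; nothing else changes
  rintro ⟨η₁, hη₁, hCAT⟩ ⟨η₂, hη₂, hCEAT⟩ ⟨η₃, hη₃, hECT⟩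
  refine ⟨min η₁ (min η₂ η₃), lt_min hη₁ (lt_min hη₂ hη₃), ?_⟩
  intro r Rf hr hRf hRfL a₀ θ₀ u₀ ha hθ hu ha0 hθ0
  obtain ⟨σ₁, hσ₁, h1⟩ := hCAT a₀ θ₀ u₀ ha hθ hu ha0 hθ0
  obtain ⟨σ₂, hσ₂, h2⟩ := hCEAT a₀ θ₀ u₀ ha hθ hu ha0 hθ0
  obtain ⟨σ₃, hσ₃, h3⟩ := hECT a₀ θ₀ u₀ ha hθ hu ha0 hθ0
  refine ⟨min (min σ₁ σ₂) (min σ₃ (1 / 2)), lt_min (lt_min hσ₁ hσ₂) (lt_min hσ₃ one_half_pos),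
    fun σ hσ hσlt T ρ θ u hE hguard Φ hlim t ht hpack τ hτ ε hε => ?_⟩
  have hg1 : ∀ t' ∈ Ico 0 T, ∀ x, ρ t' x * σ ^ 3 < η₁ := fun t' ht' x => (hguard t' ht' x).trans_le (min_le_left _ _)
  have hg2 : ∀ t' ∈ Ico 0 T, ∀ x, ρ t' x * σ ^ 3 < η₂ := fun t' ht' x =>
    (hguard t' ht' x).trans_le ((min_le_right _ _).trans (min_le_left _ _))
  have hg3 : ∀ t' ∈ Ico 0 T, ∀ x, ρ t' x * σ ^ 3 < η₃ := fun t' ht' x =>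
    (hguard t' ht' x).trans_le ((min_le_right _ _).trans (min_le_right _ _))
  have hσ1 : σ < σ₁ := hσlt.trans_le ((min_le_left _ _).trans (min_le_left _ _))
  have hσ2' : σ < σ₂ := hσlt.trans_le ((min_le_left _ _).trans (min_le_right _ _))
  have hσ3 : σ < σ₃ := hσlt.trans_le ((min_le_right _ _).trans (min_le_left _ _))
  have hσhalf : σ < 1 / 2 := hσlt.trans_le ((min_le_right _ _).trans (min_le_right _ _))
  have ht0T : t ∈ Ico 0 T := ⟨ht.1.le, ht.2⟩
  have htT : Icc 0 t ⊆ Ico 0 T := Icc_subset_Ico_right ht.2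
  -- the three inputs, each at ONE fixed level
  obtain ⟨V₁, hV₁, hCAT1⟩ := h1 σ hσ hσ1 T ρ θ u hE hg1 Φ hlim t ht0T
  obtain ⟨τ₁, hτ₁, hCAT2⟩ := hCAT1 V₁ le_rfl 1 one_pos
  obtain ⟨N₁, hN₁⟩ := hCAT2 (max τ₁ τ) (le_max_left _ _)
  obtain ⟨V₂, hV₂, hCEAT1⟩ := h2 σ hσ hσ2' T ρ θ u hE hg2 Φ hlim t ht0T
  obtain ⟨τ₂, hτ₂, hCEAT2⟩ := hCEAT1 V₂ le_rfl 1 one_pos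
  obtain ⟨N₂, hN₂⟩ := hCEAT2 (max τ₂ τ) (le_max_left _ _)
  obtain ⟨M, N₃, hN₃⟩ := h3 σ hσ hσ3 T ρ θ u hE hg3 Φ hlim t ht0T 1 one_pos
  have hτ₁' : 0 < max τ₁ τ := lt_max_of_lt_left hτ₁
  have hτ₂' : 0 < max τ₂ τ := lt_max_of_lt_left hτ₂
  -- slab constants of the Euler solution
  obtain ⟨K, hK0, hK⟩ :=
    exists_abs_DgExp_one_le hE.smooth_temperature hE.smooth_velocity hE.temperature_pos ht.2
  choose Lb hLb0 hLb using fun j : Fin 3 => exists_lipschitz_slab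
    (isSmoothSpaceTimeOn_momPart hE.smooth_temperature hE.smooth_velocity hE.temperature_pos j) ht.1 ht.2
  obtain ⟨Lγ, hLγ0, hLγ⟩ := exists_lipschitz_slab
    (isSmoothSpaceTimeOn_inv hE.smooth_temperature hE.temperature_pos) ht.1 ht.2
  have hSL0 : 0 ≤ ∑ j, Lb j := Finset.sum_nonneg fun j _ => hLb0 j
  set L : ℝ := ∑ j, Lb j + Lγ with hLdef
  have hL0 : 0 ≤ L := by positivity
  have hd0 : ∀ x x' : T3, 0 ≤ Torus.euclidDist x x' := fun x x' => by
    rw [Torus.euclidDist_eq]; exact norm_nonneg _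
  have hβ : ∀ r' ∈ Icc 0 t, ∀ (x x' : T3) (j : Fin 3),
      |u r' x j / θ r' x - u r' x' j / θ r' x'| ≤ L * Torus.euclidDist x x' := by
    intro r' hr' x x' j
    have h := hLb j r' hr' r' hr' x x'
    rw [sub_self, abs_zero, zero_add, Real.norm_eq_abs] at h
    refine h.trans (mul_le_mul_of_nonneg_right ?_ (hd0 x x'))
    have := Finset.single_le_sum (fun j _ => hLb0 j) (Finset.mem_univ j)
    rw [hLdef]
    linarith
  have hγ : ∀ r' ∈ Icc 0 t, ∀ x x' : T3, |(θ r' x)⁻¹ - (θ r' x')⁻¹| ≤ L * Torus.euclidDist x x' := by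
    intro r' hr' x x'
    have h := hLγ r' hr' r' hr' x x'
    rw [sub_self, abs_zero, zero_add, Real.norm_eq_abs] at h
    refine h.trans (mul_le_mul_of_nonneg_right ?_ (hd0 x x'))
    rw [hLdef]
    linarith
  obtain ⟨Kρ, hKρ0, hKρ⟩ := exists_lipschitz_slab hE.smooth_density ht.1 ht.2
  -- a positive lower bound on the density over the slab
  obtain ⟨Ki, hKi⟩ := (isSmoothSpaceTimeOn_inv hE.smooth_density hE.density_pos).exists_norm_le_of_isCompact
    isCompact_Icc htT
  have hm : ∀ s₁ ∈ Icc 0 t, ∀ x, (|Ki| + 1)⁻¹ ≤ ρ s₁ x := by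
    intro s₁ hs₁ x
    have hρ := hE.density_pos s₁ (htT hs₁) x
    have h := hKi s₁ hs₁ x
    rw [Real.norm_eq_abs] at h
    rw [inv_le_comm₀ (by positivity) hρ]
    linarith [le_abs_self (ρ s₁ x)⁻¹, le_abs_self Ki]
  -- the Lipschitz constant of the insertion factor
  obtain ⟨LR, hLR⟩ := hRfL
  -- the second moment of the velocities at time zero
  obtain ⟨U, -, hU⟩ := exists_forall_abs_le_of_continuous (χ := fun x => ‖u₀ x‖) hu.norm
  obtain ⟨Θ, -, hΘ⟩ := exists_forall_abs_le_of_continuous hθ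
  have hΘ0 : 0 ≤ Θ := (abs_nonneg _).trans (hΘ 0)
  have hCKE0 : 0 ≤ U ^ 2 + 3 * Θ := by positivity
  have hKE : ∀ N, ∫⁻ z, ENNReal.ofReal (((N : ℝ) + 1)⁻¹ * ∑ i, ‖(z i).2‖ ^ 2)
      ∂(localGibbsLaw σ a₀ u₀ θ₀ N (Φ N)) ≤ ENNReal.ofReal (U ^ 2 + 3 * Θ) := by
    intro N
    rw [localGibbsLaw_eq]
    refine lintegral_meanVelObs_localGibbsMeasure_le ha hθ hu (fun x => (ha0 x).le) hθ0
      (f := fun v : V3 => ‖v‖ ^ 2) (by fun_prop) (fun v => sq_nonneg _) (fun y => ?_) σ N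
    rw [lintegral_norm_sq_gaussMeasure (u₀ y) (hθ0 y)]
    have h1 : ‖u₀ y‖ ≤ U := by simpa only [abs_of_nonneg (norm_nonneg _)] using hU y
    exact ENNReal.ofReal_le_ofReal (by
      nlinarith [(le_abs_self _).trans (hΘ y), pow_le_pow_left₀ (norm_nonneg _) h1 2])
  -- the total constant and the threshold in `N`
  set A₁ : ℝ := K * (2 + max M 0 * (U ^ 2 + 3 * Θ)) +
    (((|Ki| + 1)⁻¹)⁻¹ + LR * σ ^ 3) * Kρ * (3 + (U ^ 2 + 3 * Θ)) / 2 +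
    (((|Ki| + 1)⁻¹)⁻¹ + LR * σ ^ 3) * Kρ with hA₁
  have hA₁0 : 0 ≤ A₁ := by positivity
  set Ktot : ℝ := τ * A₁ + 4 * L * (max τ₁ τ * (V₁ + 1) + max τ₂ τ * (V₂ + 1)) + 1 with hKtot
  have hKtot0 : 0 < Ktot := by positivity
  have hν : Tendsto (fun N : ℕ => ((N : ℝ) + 1) ^ (-(1 / 3 : ℝ))) atTop (𝓝 0) :=
    (tendsto_rpow_neg_atTop (by norm_num : (0 : ℝ) < 1 / 3)).comp
      (tendsto_atTop_add_const_right _ 1 tendsto_natCast_atTop_atTop)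
  obtain ⟨N₄, hN₄⟩ := eventually_atTop.1 (hν.eventually_lt_const (div_pos hε hKtot0))
  refine ⟨max (max N₁ N₂) (max N₃ N₄), fun N hN s hs s' hs' hss' hs'le => ?_⟩
  have hN1 : N₁ ≤ N := ((le_max_left _ _).trans (le_max_left _ _)).trans hN
  have hN2 : N₂ ≤ N := ((le_max_right _ _).trans (le_max_left _ _)).trans hN
  have hN3 : N₃ ≤ N := ((le_max_left _ _).trans (le_max_right _ _)).trans hN
  have hN4 : N₄ ≤ N := ((le_max_right _ _).trans (le_max_right _ _)).trans hN
  set ν : ℝ := ((N : ℝ) + 1) ^ (-(1 / 3 : ℝ)) with hνdef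
  have hν0 : 0 < ν := Real.rpow_pos_of_pos (by positivity) _
  have hνle : ν ≤ ε / Ktot := (hN₄ N hN4).le
  have hεN : hsDiameter σ N = σ * ν := by
    rw [hνdef, hsDiameter]
    push_cast
    ring
  -- the one-window estimate at this `N`
  have hmain := abs_klDiv_window_sub_le hσ hσhalf ha hθ hu ha0 hθ0 hE ht hRf hLR hpack N (Φ N) hK0 hK hL0 hβ hγ
    hKρ0 hKρ (m := (|Ki| + 1)⁻¹) (by positivity) hm hCKE0 (hKE N) (M := M)
    (fun r' hr' => hN₃ N hN3 r' hr') hV₁.le (κ₁ := σ / max τ₁ τ) (w₁ := max τ₁ τ * ν) (div_pos hσ hτ₁')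
    (fun s₁ hs₁ => by
      have h := hN₁ N hN1 s₁ hs₁
      dsimp only at h
      exact h)
    hV₂.le (κ₂ := σ / max τ₂ τ) (w₂ := max τ₂ τ * ν) (div_pos hσ hτ₂')
    (fun s₁ hs₁ => by
      have h := hN₂ N hN2 s₁ hs₁
      dsimp only at h
      exact h)
    hs hs' hss'
    (hs'le.trans (add_le_add le_rfl (mul_le_mul_of_nonneg_right (le_max_right τ₁ τ) hν0.le)))
    (hs'le.trans (add_le_add le_rfl (mul_le_mul_of_nonneg_right (le_max_right τ₂ τ) hν0.le)))
  refine hmain.trans ?_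
  -- bookkeeping: everything is `(N+1) ν_N · const`
  have hN0 : (0 : ℝ) < (N : ℝ) + 1 := by positivity
  have hss : s' - s ≤ τ * ν := by linarith [hs'le]
  have step1 : (s' - s) * (((N : ℝ) + 1) * A₁) ≤ τ * ν * (((N : ℝ) + 1) * A₁) :=
    mul_le_mul_of_nonneg_right hss (by positivity)
  have step2 : 4 * L * hsDiameter σ N *
      (((N : ℝ) + 1) * ((σ / max τ₁ τ)⁻¹ * (V₁ + 1) + (σ / max τ₂ τ)⁻¹ * (V₂ + 1))) =
      ν * ((N : ℝ) + 1) * (4 * L * (max τ₁ τ * (V₁ + 1) + max τ₂ τ * (V₂ + 1))) := by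
    rw [hεN, inv_div, inv_div]
    field_simp
  have hνK : ν * Ktot ≤ ε := by rwa [← le_div_iff₀ hKtot0]
  calc (s' - s) * (((N : ℝ) + 1) * A₁) + 4 * L * hsDiameter σ N *
        (((N : ℝ) + 1) * ((σ / max τ₁ τ)⁻¹ * (V₁ + 1) + (σ / max τ₂ τ)⁻¹ * (V₂ + 1)))
      ≤ τ * ν * (((N : ℝ) + 1) * A₁) +
          ν * ((N : ℝ) + 1) * (4 * L * (max τ₁ τ * (V₁ + 1) + max τ₂ τ * (V₂ + 1))) := by
        rw [step2]
        linarith [step1]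
    _ = ((N : ℝ) + 1) * (ν * (Ktot - 1)) := by
        rw [hKtot]
        ring
    _ ≤ ((N : ℝ) + 1) * (ν * Ktot) := by
        refine mul_le_mul_of_nonneg_left (mul_le_mul_of_nonneg_left (by linarith) hν0.le) hN0.le
    _ ≤ ((N : ℝ) + 1) * ε := mul_le_mul_of_nonneg_left hνK hN0.le

end Summit.AtomisticToContinuum.HydrodynamicLimit.Theorems.HydroLimitGuardedWindowContinuity

end
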